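import Summits.Schanuel.Schanuel.Theorems.ZilberEacComplexGraphEscapeTopLemmas
import HarnessLib

/-!
# Small lemmas for the parametrised escape theorem

Bookkeeping facts shared by the escape theorems over graph bases (`ZilberEacComplexGraphEscapeParam.lean`;
Exponential-Algebraic Closedness, first open rung `dim π₁(V) = n - 1`, Mantova–Masser, PLMS 129 (2024),
§1 p. 5): the lattice constant `α τ₀ᴰ = 2πiσk`, the escaping coordinate `τ = e^{Λ}` on the unit
polydisc, and the final resummation `e^{ντ}(T + Σ A_m e^{(m-ν)τ}) = T e^{ντ} + Σ A_m e^{mτ}`.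
HONEST FRAMING: auxiliary; nothing here bears on Schanuel's conjecture.
-/

noncomputable section

open Complex MvPolynomial Metric Set Filter Topology

set_option linter.dupNamespace false

namespace Summit.Schanuel.Schanuel.Theorems

/-- The lattice constant: if `α (e^{iθ₀})ᴰ = iσ‖α‖` and `rᴰ = 2πk/‖α‖` then
`α (r e^{iθ₀})ᴰ = 2πkσ·i`. [folklore] -/
theorem latticeConst_eq {α : ℂ} (hα : α ≠ 0) {D : ℕ} {θ₀ σ r : ℝ} {k : ℕ}
    (hroot : α * exp (θ₀ * I) ^ D = I * σ * ‖α‖) (hrD : r ^ D = 2 * Real.pi * k / ‖α‖) :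
    α * ((r : ℂ) * exp (θ₀ * I)) ^ D = ((2 * Real.pi * k * σ : ℝ) : ℂ) * I := by
  have hαC : ((‖α‖ : ℝ) : ℂ) ≠ 0 := by exact_mod_cast (norm_pos_iff.mpr hα).ne'
  have h1 : (r : ℂ) ^ D = ((2 * Real.pi * k / ‖α‖ : ℝ) : ℂ) := by rw [← Complex.ofReal_pow, hrD]
  calc α * ((r : ℂ) * exp (θ₀ * I)) ^ D = (r : ℂ) ^ D * (α * exp (θ₀ * I) ^ D) := by
        rw [mul_pow]; ring
    _ = ((2 * Real.pi * k / ‖α‖ : ℝ) : ℂ) * (I * σ * ‖α‖) := by rw [h1, hroot]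
    _ = ((2 * Real.pi * k * σ : ℝ) : ℂ) * I := by
        push_cast
        rw [div_mul_eq_mul_div, div_eq_iff hαC]
        ring

/-- **The escaping coordinate on the unit polydisc.** For `D ≥ 2`, `|θ₀| ≤ π/(2D)`, `r ≥ 1` and
`‖η‖ ≤ 1`, with `Λ = log r + iθ₀ + η/D` and `τ = e^{Λ}`: `Re τ ≥ r/12`, `r/2 ≤ ‖τ‖ ≤ 2r` and
`‖Λ‖ ≤ log r + π + 1`. [folklore] -/
theorem escapeCoord_facts {D : ℕ} (hD : 2 ≤ D) {θ₀ : ℝ} (hθ₀ : |θ₀| ≤ Real.pi / (2 * D))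
    {r : ℝ} (hr : 1 ≤ r) {η : ℂ} (hη : ‖η‖ ≤ 1) :
    r / 12 ≤ (exp ((Real.log r : ℂ) + θ₀ * I + η * (D : ℂ)⁻¹)).re ∧
      r / 2 ≤ ‖exp ((Real.log r : ℂ) + θ₀ * I + η * (D : ℂ)⁻¹)‖ ∧
      ‖exp ((Real.log r : ℂ) + θ₀ * I + η * (D : ℂ)⁻¹)‖ ≤ 2 * r ∧
      ‖(Real.log r : ℂ) + θ₀ * I + η * (D : ℂ)⁻¹‖ ≤ Real.log r + Real.pi + 1 := by
  have hrpos : 0 < r := by linarith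
  have hDpos : 0 < D := by omega
  obtain ⟨e1, e2⟩ := exp_logCoord r θ₀ η D hDpos
  rw [e1, Real.exp_log hrpos]
  have hθπ : |θ₀| ≤ Real.pi := hθ₀.trans (by
    rw [div_le_iff₀ (by positivity)]
    nlinarith [Real.pi_pos, (show (1 : ℝ) ≤ D by exact_mod_cast hDpos)])
  refine ⟨re_escape_ge hD hθ₀ hrpos.le hη, (norm_escape_le hD θ₀ hrpos.le hη).1,
    (norm_escape_le hD θ₀ hrpos.le hη).2, e2.trans ?_⟩
  rw [abs_of_nonneg (Real.log_nonneg hr)]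
  linarith

/-- **Resummation of a fibre expansion**: `e^{ντ}(T + Σ_{m ∈ S} A_m e^{(m-ν)τ}) = T e^{ντ} + Σ A_m e^{mτ}`.
[folklore] -/
theorem exp_mul_fibreSum (ν : ℤ) (τ T : ℂ) (S : Finset ℤ) (A : ℤ → ℂ) :
    exp ((ν : ℂ) * τ) * (T + ∑ m ∈ S, A m * exp (((m : ℂ) - (ν : ℂ)) * τ)) =
      T * exp ((ν : ℂ) * τ) + ∑ m ∈ S, A m * exp ((m : ℂ) * τ) := by
  rw [mul_add, Finset.mul_sum]
  congr 1
  · ring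
  · refine Finset.sum_congr rfl fun m _ => ?_
    rw [mul_left_comm, ← Complex.exp_add]; congr 2; ring

/-- The fibre identity behind `e^{z} = 1 + (X - a)·a⁻¹`: then `a e^{z} = X` (`a ≠ 0`). [folklore] -/
theorem mul_exp_eq_of_exp_eq {a z X : ℂ} (ha : a ≠ 0) (hz : exp z = 1 + (X - a) * a⁻¹) :
    a * exp z = X := by
  rw [hz, mul_add, mul_one, mul_comm (X - a), ← mul_assoc, mul_inv_cancel₀ ha, one_mul]
  ring

end Summit.Schanuel.Schanuel.Theorems
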